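import Summits.NavierStokesRegularity.FluidComputer.PalasekTowerLundgrenChildSwirlRelaxation
import Literature.Analysis.FluidPDE.BiotSavart2DRadialEvaluation
import Literature.Analysis.FluidPDE.BurgersVortexPeakSpeed

/-!
# REGISTER v2.3″ (continued): THE SPEED FACE PINNED — after the entropy clock the swirl of a Lundgren-carried
# child with ANY positive log-tame cross-section lies in the BURGERS BRACKET
# `[(0.0502 − δ), (0.0563 + δ)] · Γ (λA_k)^{1/2}` (ratio `< 5/3` for `δ ≤ 1/100`)

Cell `ns-blowup`, seat `ns-blowup-ecbridge-8` (g9); evidence toward crux 19250 `HeredityFromTwo`, SPEED face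
(`stub_speed_floors` / `SpeedFloorAt k` and the speed part of `WindowCeilingAt k`), MODEL lane «child core =
cross-section of Lundgren's stretched flow in the host strain `c = λA_k` at `ν = 1`, ANY positive log-tame
profile» (setting of `PalasekTowerLundgrenChildSwirlRelaxation`).

The comparison field of `…ChildSwirlRelaxation` — the Biot–Savart swirl `K₂ ∗ ω_B` of the Burgers
cross-section — is now EVALUATED (Literature `BiotSavart2DRadialEvaluation.biotSavart2D_burgersVorticity_slice`:
`K₂ ∗ (ω_B ∘ ι) = π ∘ v_B ∘ ι`, the closed-form Burgers swirl `Γ(2πr²)⁻¹(1 − e^{−cr²/4})(−y₁, y₀)`), whose sup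
is bracketed in the tree (`BurgersVortexPeakSpeed.burgersVortexSwirl_peak_bracket`:
`(79/125)K ≤ sup|v_B| ≤ K/√2`, `K = Γc^{1/2}/(4π)`, printed sharp value `0.638K`). Hence, with the clock defect
`D(s) = 0.52 (Γc)^{1/2}(2ΓH₀)^{1/4} e^{−cs/4}` of `…_childSwirl_relaxation_after_one_strain_time` (`cs ≥ 1`):

* `palasekTowerBreakdown_anyProfile_childSwirl_le_burgersPeak_clock` — **ceiling**
  `‖swirl(s, y)‖ ≤ Γc^{1/2}/(4π√2) + D(s)` at every `y`;
* `palasekTowerBreakdown_anyProfile_childSwirl_ge_burgersPeak_clock` — **floor**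
  `‖swirl(s, y)‖ ≥ (79/125)·Γc^{1/2}/(4π) − D(s)` at SOME `y` (the projection of a point where the Burgers
  swirl is large, two core radii out);
* `palasekTowerBreakdown_anyProfile_childSwirl_burgersBracket` — once `0.52(2ΓH₀)^{1/4} ≤ δΓ^{1/2}e^{cs/4}`:
  **`(0.0502 − δ)·Γ(λA_k)^{1/2} ≤ sup_y ‖swirl(s, y)‖ ≤ (0.0563 + δ)·Γ(λA_k)^{1/2}`** (as `∀`/`∃` statements).

REGISTER READING. g8 (CEILING-ANYPROFILE-19250-v4, README § g8) recorded the any-profile speed band as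
`P ∈ [0.0398ρ^{−1/2}, 0.3556]·Γ(λA_k)^{1/2}` — «intrinsically wider than `c₂/c₁ = 5/3`». For POSITIVE LOG-TAME
cross-sections this is overturned asymptotically: after `λA_k s ≥ log(0.1462·H₀/Γ) + 4 log(1/δ)` strain times the
band is the Burgers bracket widened by `δ`, e.g. `δ = 1/100`: `[0.0402, 0.0663]`, ratio `1.65 < 5/3`;
`δ = 1/200`: `[0.0452, 0.0613]`, ratio `1.36`. WHAT THIS IS NOT: not NS about registered flows; no Stage;
positivity/log-tameness are hypotheses; the statements concern the SWIRL part `e^{cs/2}ṽ` of the child's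
velocity; the bracket's own width (`0.0563/0.0502 = 1.12`) is the tree's elementary Burgers-peak bracket, not the
printed sharp peak `0.0508`.

## References
* [cite: GallayWayne2005, §3.4 (arXiv:math/0402449 p. 14)] · [cite: GallayWayne2006, §1 eq. (1.5)]
* [cite: MajdaBertozziCUP2002, §2.2.1 Example 2.1 eq. (2.14) (held text p. 45)]
* [cite: Saffman1992, §13.1 eq. (4) and §13.3 eq. (31) (the Burgers peak `0.0508·Γ(γ/ν)^{1/2}`)]
-/

noncomputable section

namespace Summit.NavierStokesRegularity.FluidComputer.PalasekTowerClayBridge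

open Real Set MeasureTheory
open Literature.Analysis.FluidPDE Literature.Analysis.FluidPDE.Lundgren

variable {S' : Set ℝ}
  {v : ℝ → EuclideanSpace ℝ (Fin 2) → EuclideanSpace ℝ (Fin 2)}
  {q : ℝ → EuclideanSpace ℝ (Fin 2) → ℝ}

namespace SwirlBurgersBracket

/-- The Burgers swirl depends only on the horizontal coordinates: `v_B(ι(π x)) = v_B(x)`. [folklore] -/
theorem burgersVortexSwirl_embedXY_projXY (γ ν Γ : ℝ) (x : EuclideanSpace ℝ (Fin 3)) :
    burgersVortexSwirl γ ν Γ (embedXY (projXY x)) = burgersVortexSwirl γ ν Γ x := by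
  ext i; fin_cases i <;> simp [burgersVortexSwirl, rotGen]

/-- The Burgers swirl is horizontal, so `‖π(v_B(x))‖ = ‖v_B(x)‖`. [folklore] -/
theorem norm_projXY_burgersVortexSwirl (γ ν Γ : ℝ) (x : EuclideanSpace ℝ (Fin 3)) :
    ‖projXY (burgersVortexSwirl γ ν Γ x)‖ = ‖burgersVortexSwirl γ ν Γ x‖ := by
  rw [EuclideanSpace.norm_eq, EuclideanSpace.norm_eq, Fin.sum_univ_two, Fin.sum_univ_three]
  simp

/-- `1/(4π√2) ≤ 0.0563`. [folklore] -/
theorem inv_sqrt_two_div_four_pi_le : (Real.sqrt 2)⁻¹ * (1 / (4 * π)) ≤ 0.0563 := by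
  have hπ : 3.141592 < π := pi_gt_d6
  have hs : 1.41421 < Real.sqrt 2 := by
    rw [show (1.41421 : ℝ) = Real.sqrt (1.41421 ^ 2) by rw [Real.sqrt_sq (by norm_num)]]
    exact Real.sqrt_lt_sqrt (by norm_num) (by norm_num)
  have h1 : (Real.sqrt 2)⁻¹ ≤ 0.70711 := by
    rw [inv_le_comm₀ (by positivity) (by norm_num)]
    norm_num
    linarith
  have h2 : 1 / (4 * π) ≤ 0.079578 := by
    rw [div_le_iff₀ (by positivity)]
    linarith
  calc (Real.sqrt 2)⁻¹ * (1 / (4 * π)) ≤ 0.70711 * 0.079578 :=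
        mul_le_mul h1 h2 (by positivity) (by norm_num)
    _ ≤ 0.0563 := by norm_num

/-- `(79/125)/(4π) ≥ 0.0502`. [folklore] -/
theorem peak_floor_const_ge : 0.0502 ≤ (79 / 125 : ℝ) * (1 / (4 * π)) := by
  have hπ : π < 3.1416 := pi_lt_d4
  rw [← div_eq_mul_one_div, le_div_iff₀ (by positivity)]
  nlinarith

end SwirlBurgersBracket

open SwirlBurgersBracket

/-! ### §1 Ceiling and floor after one strain time -/

/-- **CEILING: `‖swirl(s, y)‖ ≤ Γc^{1/2}/(4π√2) + 0.52(Γc)^{1/2}(2ΓH₀)^{1/4}e^{−cs/4}`** (setting of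
`…_childSwirl_relaxation_after_one_strain_time`, `cs ≥ 1`): the child swirl is within the clock defect of
`K₂ ∗ (ω_B ∘ ι) = π ∘ v_B ∘ ι`, and `‖v_B‖ ≤ Γc^{1/2}/(4π√2)` everywhere (`norm_burgersVortexSwirl_le_peak`).
[cite: GallayWayne2005, §3.4; GallayWayne2006, §1 eq. (1.5); Saffman1992, §13.1 eq. (4)] -/
theorem palasekTowerBreakdown_anyProfile_childSwirl_le_burgersPeak_clock (R : TowerRates) (k : ℕ)
    {l : ℝ} (hl : 0 < l) (hS' : Convex ℝ S') (hv : IsClassicalNSSolutionOn S' 1 0 v q)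
    (hω : HasUniformRapidDecayOn S' (fun σ η => PlanarEigenmode.vorticity (v σ) η))
    (hBS : ∀ σ ∈ S', ∀ η, v σ η = biotSavart2D (PlanarEigenmode.vorticity (v σ)) η)
    (hpos : ∀ σ ∈ S', ∀ η, 0 < PlanarEigenmode.vorticity (v σ) η) {L : ℝ} {m : ℕ}
    (hlog : ∀ σ ∈ S', ∀ η, |Real.log (PlanarEigenmode.vorticity (v σ) η)| ≤ L * (1 + ‖η‖) ^ m)
    (hsc : ∀ σ ∈ S', ∀ η, ‖fderiv ℝ (PlanarEigenmode.vorticity (v σ)) η‖ ≤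
      L * (1 + ‖η‖) ^ m * PlanarEigenmode.vorticity (v σ) η)
    (h0 : (0 : ℝ) ∈ S') {s : ℝ} (hs1 : 1 ≤ l * R.A k * s)
    (hτs : (exp (l * R.A k * s) - 1) / (l * R.A k) ∈ S') (y : EuclideanSpace ℝ (Fin 2)) :
    ‖exp (l * R.A k * s / 2) • v ((exp (l * R.A k * s) - 1) / (l * R.A k)) (exp (l * R.A k * s / 2) • y)‖ ≤
      (Real.sqrt 2)⁻¹ * ((∫ η, PlanarEigenmode.vorticity (v 0) η) * Real.sqrt (l * R.A k) / (4 * π)) +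
        0.52 * Real.sqrt ((∫ η, PlanarEigenmode.vorticity (v 0) η) * (l * R.A k)) *
          Real.sqrt (Real.sqrt (2 * (∫ η, PlanarEigenmode.vorticity (v 0) η) *
            ∫ η, PlanarEigenmode.vorticity (v 0) η *
              Real.log (PlanarEigenmode.vorticity (v 0) η /
                ((∫ y, PlanarEigenmode.vorticity (v 0) y) / (4 * π * (l * R.A k)⁻¹) *
                  exp (-(‖η‖ ^ 2 / (4 * (l * R.A k)⁻¹))))))) *
          exp (-(l * R.A k * s / 4)) := by
  set c : ℝ := l * R.A k with hc
  have hcpos : 0 < c := mul_pos hl (R.A_pos k)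
  set Γ : ℝ := ∫ η, PlanarEigenmode.vorticity (v 0) η with hΓ
  have hΓ0 : 0 ≤ Γ := integral_nonneg fun η => (hpos 0 h0 η).le
  have hrel := palasekTowerBreakdown_anyProfile_childSwirl_relaxation_after_one_strain_time R k hl hS' hv hω
    hBS hpos hlog hsc h0 hs1 hτs y
  have hid := (biotSavart2D_burgersVorticity_slice hcpos one_pos Γ y).2
  have hpeak := (burgersVortexSwirl_peak_bracket hcpos one_pos Γ).1 (embedXY y)
  rw [div_one, abs_of_nonneg hΓ0] at hpeak
  have hB : ‖biotSavart2D (fun y' => burgersVorticity c 1 Γ (embedXY y')) y‖ ≤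
      (Real.sqrt 2)⁻¹ * (Γ * Real.sqrt c / (4 * π)) := by
    rw [hid, norm_projXY_burgersVortexSwirl]; exact hpeak
  have htri := norm_le_norm_add_norm_sub'
    (exp (c * s / 2) • v ((exp (c * s) - 1) / c) (exp (c * s / 2) • y))
    (biotSavart2D (fun y' => burgersVorticity c 1 Γ (embedXY y')) y)
  linarith

/-- **FLOOR: `‖swirl(s, y)‖ ≥ (79/125)·Γc^{1/2}/(4π) − 0.52(Γc)^{1/2}(2ΓH₀)^{1/4}e^{−cs/4}` AT SOME `y`**
(same setting): at the projection of a point where the Burgers swirl reaches `(79/125)K`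
(`exists_norm_burgersVortexSwirl_ge`, two core radii from the axis).
[cite: GallayWayne2005, §3.4; GallayWayne2006, §1 eq. (1.5); Saffman1992, §13.1 eq. (4)] -/
theorem palasekTowerBreakdown_anyProfile_childSwirl_ge_burgersPeak_clock (R : TowerRates) (k : ℕ)
    {l : ℝ} (hl : 0 < l) (hS' : Convex ℝ S') (hv : IsClassicalNSSolutionOn S' 1 0 v q)
    (hω : HasUniformRapidDecayOn S' (fun σ η => PlanarEigenmode.vorticity (v σ) η))
    (hBS : ∀ σ ∈ S', ∀ η, v σ η = biotSavart2D (PlanarEigenmode.vorticity (v σ)) η)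
    (hpos : ∀ σ ∈ S', ∀ η, 0 < PlanarEigenmode.vorticity (v σ) η) {L : ℝ} {m : ℕ}
    (hlog : ∀ σ ∈ S', ∀ η, |Real.log (PlanarEigenmode.vorticity (v σ) η)| ≤ L * (1 + ‖η‖) ^ m)
    (hsc : ∀ σ ∈ S', ∀ η, ‖fderiv ℝ (PlanarEigenmode.vorticity (v σ)) η‖ ≤
      L * (1 + ‖η‖) ^ m * PlanarEigenmode.vorticity (v σ) η)
    (h0 : (0 : ℝ) ∈ S') {s : ℝ} (hs1 : 1 ≤ l * R.A k * s)
    (hτs : (exp (l * R.A k * s) - 1) / (l * R.A k) ∈ S') :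
    ∃ y : EuclideanSpace ℝ (Fin 2),
      (79 / 125) * ((∫ η, PlanarEigenmode.vorticity (v 0) η) * Real.sqrt (l * R.A k) / (4 * π)) -
          0.52 * Real.sqrt ((∫ η, PlanarEigenmode.vorticity (v 0) η) * (l * R.A k)) *
            Real.sqrt (Real.sqrt (2 * (∫ η, PlanarEigenmode.vorticity (v 0) η) *
              ∫ η, PlanarEigenmode.vorticity (v 0) η *
                Real.log (PlanarEigenmode.vorticity (v 0) η /
                  ((∫ y, PlanarEigenmode.vorticity (v 0) y) / (4 * π * (l * R.A k)⁻¹) *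
                    exp (-(‖η‖ ^ 2 / (4 * (l * R.A k)⁻¹))))))) *
            exp (-(l * R.A k * s / 4)) ≤
        ‖exp (l * R.A k * s / 2) • v ((exp (l * R.A k * s) - 1) / (l * R.A k)) (exp (l * R.A k * s / 2) • y)‖ := by
  set c : ℝ := l * R.A k with hc
  have hcpos : 0 < c := mul_pos hl (R.A_pos k)
  set Γ : ℝ := ∫ η, PlanarEigenmode.vorticity (v 0) η with hΓ
  have hΓ0 : 0 ≤ Γ := integral_nonneg fun η => (hpos 0 h0 η).le
  obtain ⟨x₃, hx₃⟩ := (burgersVortexSwirl_peak_bracket hcpos one_pos Γ).2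
  rw [div_one, abs_of_nonneg hΓ0] at hx₃
  refine ⟨projXY x₃, ?_⟩
  have hrel := palasekTowerBreakdown_anyProfile_childSwirl_relaxation_after_one_strain_time R k hl hS' hv hω
    hBS hpos hlog hsc h0 hs1 hτs (projXY x₃)
  have hid := (biotSavart2D_burgersVorticity_slice hcpos one_pos Γ (projXY x₃)).2
  have hB : (79 / 125) * (Γ * Real.sqrt c / (4 * π)) ≤
      ‖biotSavart2D (fun y' => burgersVorticity c 1 Γ (embedXY y')) (projXY x₃)‖ := by
    rw [hid, norm_projXY_burgersVortexSwirl, burgersVortexSwirl_embedXY_projXY]; exact hx₃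
  have htri := norm_sub_norm_le
    (biotSavart2D (fun y' => burgersVorticity c 1 Γ (embedXY y')) (projXY x₃))
    (exp (c * s / 2) • v ((exp (c * s) - 1) / c) (exp (c * s / 2) • projXY x₃))
  rw [norm_sub_rev] at htri
  linarith

/-! ### §2 The Burgers bracket as numbers -/

/-- **THE SPEED FACE PINNED TO THE BURGERS BRACKET** (same setting; `cs ≥ 1`): once
`0.52 (2ΓH₀)^{1/4} ≤ δ Γ^{1/2} e^{cs/4}` (after `λA_k s ≥ log(0.1462·H₀/Γ) + 4 log(1/δ)` strain times),
**`‖swirl(s, y)‖ ≤ (0.0563 + δ)·Γ(λA_k)^{1/2}` at every `y`, and `‖swirl(s, y)‖ ≥ (0.0502 − δ)·Γ(λA_k)^{1/2}` at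
some `y`** (`1/(4π√2) ≤ 0.0563`, `(79/125)/(4π) ≥ 0.0502`). For `δ = 1/100` the ratio of the two constants is
`0.0663/0.0402 < 5/3 = c₂/c₁`. MODEL statement; not about any registered flow.
[cite: GallayWayne2005, §3.4; Saffman1992, §13.1 eq. (4) and §13.3 eq. (31)] -/
theorem palasekTowerBreakdown_anyProfile_childSwirl_burgersBracket (R : TowerRates) (k : ℕ)
    {l : ℝ} (hl : 0 < l) (hS' : Convex ℝ S') (hv : IsClassicalNSSolutionOn S' 1 0 v q)
    (hω : HasUniformRapidDecayOn S' (fun σ η => PlanarEigenmode.vorticity (v σ) η))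
    (hBS : ∀ σ ∈ S', ∀ η, v σ η = biotSavart2D (PlanarEigenmode.vorticity (v σ)) η)
    (hpos : ∀ σ ∈ S', ∀ η, 0 < PlanarEigenmode.vorticity (v σ) η) {L : ℝ} {m : ℕ}
    (hlog : ∀ σ ∈ S', ∀ η, |Real.log (PlanarEigenmode.vorticity (v σ) η)| ≤ L * (1 + ‖η‖) ^ m)
    (hsc : ∀ σ ∈ S', ∀ η, ‖fderiv ℝ (PlanarEigenmode.vorticity (v σ)) η‖ ≤
      L * (1 + ‖η‖) ^ m * PlanarEigenmode.vorticity (v σ) η)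
    (h0 : (0 : ℝ) ∈ S') {s : ℝ} (hs1 : 1 ≤ l * R.A k * s)
    (hτs : (exp (l * R.A k * s) - 1) / (l * R.A k) ∈ S') {δ : ℝ}
    (hclock : 0.52 * Real.sqrt (Real.sqrt (2 * (∫ η, PlanarEigenmode.vorticity (v 0) η) *
          ∫ η, PlanarEigenmode.vorticity (v 0) η *
            Real.log (PlanarEigenmode.vorticity (v 0) η /
              ((∫ y, PlanarEigenmode.vorticity (v 0) y) / (4 * π * (l * R.A k)⁻¹) *
                exp (-(‖η‖ ^ 2 / (4 * (l * R.A k)⁻¹))))))) ≤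
        δ * Real.sqrt (∫ η, PlanarEigenmode.vorticity (v 0) η) * exp (l * R.A k * s / 4)) :
    (∀ y : EuclideanSpace ℝ (Fin 2),
        ‖exp (l * R.A k * s / 2) • v ((exp (l * R.A k * s) - 1) / (l * R.A k)) (exp (l * R.A k * s / 2) • y)‖ ≤
          (0.0563 + δ) * ((∫ η, PlanarEigenmode.vorticity (v 0) η) * Real.sqrt (l * R.A k))) ∧
      ∃ y : EuclideanSpace ℝ (Fin 2),
        (0.0502 - δ) * ((∫ η, PlanarEigenmode.vorticity (v 0) η) * Real.sqrt (l * R.A k)) ≤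
          ‖exp (l * R.A k * s / 2) • v ((exp (l * R.A k * s) - 1) / (l * R.A k)) (exp (l * R.A k * s / 2) • y)‖ := by
  set c : ℝ := l * R.A k with hc
  have hcpos : 0 < c := mul_pos hl (R.A_pos k)
  set Γ : ℝ := ∫ η, PlanarEigenmode.vorticity (v 0) η with hΓ
  have hΓ0 : 0 ≤ Γ := integral_nonneg fun η => (hpos 0 h0 η).le
  set D : ℝ := 0.52 * Real.sqrt (Γ * c) * Real.sqrt (Real.sqrt (2 * Γ *
    ∫ η, PlanarEigenmode.vorticity (v 0) η *
      Real.log (PlanarEigenmode.vorticity (v 0) η /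
        (Γ / (4 * π * c⁻¹) * exp (-(‖η‖ ^ 2 / (4 * c⁻¹))))))) * exp (-(c * s / 4)) with hD
  -- the defect is `≤ δ Γ √c`
  have hunit : 0 ≤ Γ * Real.sqrt c := by positivity
  have hDδ : D ≤ δ * (Γ * Real.sqrt c) := by
    have hee : exp (c * s / 4) * exp (-(c * s / 4)) = 1 := by
      rw [← Real.exp_add, add_neg_cancel, Real.exp_zero]
    have hΓΓ : Real.sqrt Γ * Real.sqrt Γ = Γ := Real.mul_self_sqrt hΓ0
    rw [hD, Real.sqrt_mul hΓ0 c]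
    calc 0.52 * (Real.sqrt Γ * Real.sqrt c) * Real.sqrt (Real.sqrt (2 * Γ * _)) * exp (-(c * s / 4))
        = (0.52 * Real.sqrt (Real.sqrt (2 * Γ * _))) * (Real.sqrt Γ * Real.sqrt c * exp (-(c * s / 4))) := by
          ring
      _ ≤ (δ * Real.sqrt Γ * exp (c * s / 4)) * (Real.sqrt Γ * Real.sqrt c * exp (-(c * s / 4))) :=
          mul_le_mul_of_nonneg_right hclock (by positivity)
      _ = δ * (Real.sqrt Γ * Real.sqrt Γ) * Real.sqrt c * (exp (c * s / 4) * exp (-(c * s / 4))) := by ring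
      _ = δ * (Γ * Real.sqrt c) := by rw [hee, hΓΓ]; ring
  have hK1 : (Real.sqrt 2)⁻¹ * (Γ * Real.sqrt c / (4 * π)) ≤ 0.0563 * (Γ * Real.sqrt c) := by
    have := mul_le_mul_of_nonneg_right inv_sqrt_two_div_four_pi_le hunit
    calc (Real.sqrt 2)⁻¹ * (Γ * Real.sqrt c / (4 * π)) = (Real.sqrt 2)⁻¹ * (1 / (4 * π)) * (Γ * Real.sqrt c) := by
          ring
      _ ≤ 0.0563 * (Γ * Real.sqrt c) := this
  have hK2 : 0.0502 * (Γ * Real.sqrt c) ≤ (79 / 125) * (Γ * Real.sqrt c / (4 * π)) := by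
    have := mul_le_mul_of_nonneg_right peak_floor_const_ge hunit
    calc 0.0502 * (Γ * Real.sqrt c) ≤ (79 / 125 : ℝ) * (1 / (4 * π)) * (Γ * Real.sqrt c) := this
      _ = (79 / 125) * (Γ * Real.sqrt c / (4 * π)) := by ring
  refine ⟨fun y => ?_, ?_⟩
  · have h := palasekTowerBreakdown_anyProfile_childSwirl_le_burgersPeak_clock R k hl hS' hv hω hBS hpos hlog
      hsc h0 hs1 hτs y
    linarith
  · obtain ⟨y, hy⟩ := palasekTowerBreakdown_anyProfile_childSwirl_ge_burgersPeak_clock R k hl hS' hv hω hBS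
      hpos hlog hsc h0 hs1 hτs
    exact ⟨y, by linarith⟩

end Summit.NavierStokesRegularity.FluidComputer.PalasekTowerClayBridge
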